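import Summits.CriticalPhenomena.PercolationContinuityZ3.Theorems.Transplant.FKConnectivityAllQPat3ShapeOne
import Summits.CriticalPhenomena.PercolationContinuityZ3.Theorems.Transplant.FKConnectivityAllQAntipodalMinorUpc
import HarnessLib

/-!
# Connectivity correlation inequalities for `φ_{w,q}`, every `q > 0` — THE PRODUCT CONE OF A ONE-PIECE SHAPE: integer
# certificates checked by `decide` imply levelwise nonnegativity on the composite (census g39 §4 / §11 (iii)–(iv) for `t = 1`)

Definitions + theorems file (`--supports stmt-CriticalPhenomena-4575`), census lineage (gen 40) of LANE 2's FK sub-programme; builds on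
p205010 (kernel theorem, internal audit signed; external expert review pending).  No named facts, no sorries; standard axioms.

* `FK.coefTab1` (DEFINITION, computable) — the coefficient table `coef(d; P, Q)` of a one-piece shape: the table `F` summed over
  the skeleton colourings whose total correction (plus `F`'s own level) is the residual level `d`; `FK.sum_shape1Term`:
  the colouring sum of `FK.shape1Term` is `coef` at `d = μ + |L| - ℓ`.
* `FK.gentry`, `FK.certRow`, **`FK.certCheck1`** (DEFINITIONS, computable) — a generator column (a two-level table of the piece
  placed at a shift), the symmetrised certificate row `Σ λ·(column + columnᵀ)`, and the CHECK: shifts below `dmax`, indices valid,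
  and `certRow ≤ Dn · (coef + coefᵀ)` at every residual level `d ≤ dmax` and every pattern pair (a `Bool`; `decide +kernel`
  evaluates the bridge rows B1/B2 × T_sym in seconds — census g40's cross-check of g39's certificates `T@2 + 3T@1 + 2T@0` and
  `T@1 + 2·C2@0`, shifts `@t` = this file's shifts).
* **`FK.shape1C_nonneg_of_cert`** — THE CONE THEOREM (piece read as a minor `(EQ, CQ)`; `FK.shape1_nonneg_of_cert` = `CQ = ∅`): a
  passed check against generators levelwise nonnegative on the piece minor gives `F` levelwise nonnegative on the composite minor
  `(plainSet p L ∪ EQ, CQ)` (`2·Dn·lev2C = Σ_γ Dn·(coef + coefᵀ) ≥ Σ_γ certRow = Σ λ·2·lev2C(gen) ≥ 0`, the transpose by the flip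
  `γ ↦ EQ \ γ`, `FK.apExpC_compl`).
[cite: AyyerLinussonRavichandran2025, §7 (p. 22)] [cite: Grimmett2006, §1.4 eq. (1.20) (p. 15)]
-/

namespace Summit.CriticalPhenomena.PercolationContinuityZ3.Theorems

namespace FK

open SimpleGraph Literature.Probability.LatticeModels Literature.Probability.Percolation
open scoped Classical

variable {V : Type*}

/-! ### The linear product cone of a one-piece shape: certificates imply levelwise nonnegativity -/

section ShapeOneCone

variable [Fintype V] {ι : Type*} [DecidableEq ι]

omit [Fintype V] in
/-- `sumBits` is additive. [folklore] -/
theorem sumBits_add (n : ℕ) (f g : List Bool → ℤ) : sumBits n (fun bs => f bs + g bs) = sumBits n f + sumBits n g := by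
  induction n generalizing f g with
  | zero => rfl
  | succ n ih =>
    show sumBits n (fun bs => f (false :: bs) + g (false :: bs)) + sumBits n (fun bs => f (true :: bs) + g (true :: bs)) =
      sumBits n (fun bs => f (false :: bs)) + sumBits n (fun bs => f (true :: bs)) +
        (sumBits n (fun bs => g (false :: bs)) + sumBits n (fun bs => g (true :: bs)))
    rw [ih, ih]; ring

omit [Fintype V] in
/-- `sumBits` of nonnegative summands is nonnegative. [folklore] -/
theorem sumBits_nonneg (n : ℕ) {f : List Bool → ℤ} (h : ∀ bs, 0 ≤ f bs) : 0 ≤ sumBits n f := by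
  induction n generalizing f with
  | zero => exact h []
  | succ n ih => exact add_nonneg (ih fun bs => h _) (ih fun bs => h _)

/-- **The coefficient table of a one-piece shape** (census g39 §4 «coef(D, α)» for `t = 1`): at residual level `d` and piece
patterns `(P, Q)`, the sum over the skeleton colourings whose corrections (plus the table's own level) equal `d` of the table `F`
read at the composite patterns.  Computable; `decide +kernel` evaluates it. [folklore] -/
def coefTab1 (L : List (ι × ι)) (i j k ix iy is : ι) (F : ℕ → Pat3 → Pat3 → ℤ) (d : ℕ) (P Q : Pat3) : ℤ :=
  sumBits L.length fun bs =>
    (if skelCorr L i j bs P Q = d then F 0 (skelPat L i j k ix iy is bs P) (skelPat L i j k ix iy is (bs.map (! ·)) Q) else 0) +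
      (if skelCorr L i j bs P Q + 1 = d then
        F 1 (skelPat L i j k ix iy is bs P) (skelPat L i j k ix iy is (bs.map (! ·)) Q) else 0)

omit [Fintype V] in
/-- The colouring sum of `FK.shape1Term` is the coefficient table at the residual level `μ + |L| - ℓ`. [folklore] -/
theorem sum_shape1Term (L : List (ι × ι)) (i j k ix iy is : ι) (F : ℕ → Pat3 → Pat3 → ℤ) (μ ℓ : ℕ) (P Q : Pat3) :
    sumBits L.length (fun bs => shape1Term L i j k ix iy is F μ bs ℓ P Q) =
      if ℓ ≤ μ + L.length then coefTab1 L i j k ix iy is F (μ + L.length - ℓ) P Q else 0 := by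
  unfold coefTab1 shape1Term
  split_ifs with h
  · congr 1
    funext bs
    rw [ite_eq_ite_of_iff (show ℓ + skelCorr L i j bs P Q = μ + L.length ↔ skelCorr L i j bs P Q = μ + L.length - ℓ by omega)
        rfl,
      ite_eq_ite_of_iff (show ℓ + skelCorr L i j bs P Q + 1 = μ + L.length ↔
        skelCorr L i j bs P Q + 1 = μ + L.length - ℓ by omega) rfl]
  · refine sumBits_eq_zero' L.length fun bs => ?_
    have e1 : ¬ (ℓ + skelCorr L i j bs P Q = μ + L.length) := by omega
    have e2 : ¬ (ℓ + skelCorr L i j bs P Q + 1 = μ + L.length) := by omega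
    rw [if_neg e1, if_neg e2, add_zero]

/-- **A generator column** (a two-level table `g` of the piece placed at shift `t`): its entry at residual level `d`. [folklore] -/
def gentry (g : ℕ → Pat3 → Pat3 → ℤ) (t d : ℕ) (P Q : Pat3) : ℤ :=
  (if t = d then g 0 P Q else 0) + (if t + 1 = d then g 1 P Q else 0)

omit [Fintype V] [DecidableEq ι] in
/-- Summing a generator column against the configurations of the piece (read as a minor `(EQ, CQ)`) gives the generator's own
levelwise value on the minor (at level `μ + |L| - t`), or nothing. [folklore] -/
theorem sum_gentryC (EQ CQ : Finset (Sym2 V)) (u v m : V) (g : ℕ → Pat3 → Pat3 → ℤ) (t μ T : ℕ) :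
    ∑ γ ∈ EQ.powerset, (if apExpC EQ CQ γ ≤ μ + T then
        gentry g t (μ + T - apExpC EQ CQ γ) (pat3 (γ ∪ CQ) u v m) (pat3 (EQ \ γ ∪ CQ) u v m) else 0) =
      if t ≤ μ + T then lev2C EQ CQ u v m g (μ + T - t) else 0 := by
  unfold lev2C gentry
  by_cases ht : t ≤ μ + T
  · rw [if_pos ht]
    refine Finset.sum_congr rfl fun γ _ => ?_
    by_cases hl : apExpC EQ CQ γ ≤ μ + T
    · rw [if_pos hl, ite_eq_ite_of_iff (show t = μ + T - apExpC EQ CQ γ ↔ apExpC EQ CQ γ = μ + T - t by omega) rfl,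
        ite_eq_ite_of_iff (show t + 1 = μ + T - apExpC EQ CQ γ ↔ apExpC EQ CQ γ + 1 = μ + T - t by omega) rfl]
    · have e1 : ¬ (apExpC EQ CQ γ = μ + T - t) := by omega
      have e2 : ¬ (apExpC EQ CQ γ + 1 = μ + T - t) := by omega
      rw [if_neg hl, if_neg e1, if_neg e2, add_zero]
  · rw [if_neg ht]
    refine Finset.sum_eq_zero fun γ _ => ?_
    by_cases hl : apExpC EQ CQ γ ≤ μ + T
    · have e1 : ¬ (t = μ + T - apExpC EQ CQ γ) := by omega
      have e2 : ¬ (t + 1 = μ + T - apExpC EQ CQ γ) := by omega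
      rw [if_pos hl, if_neg e1, if_neg e2, add_zero]
    · rw [if_neg hl]

/-- **A certificate row**: the symmetrised combination `Σ λ · (column(P,Q) + column(Q,P))` of generator columns
(`cert` = list of `(λ, shift, generator index)`). [folklore] -/
def certRow (gens : List (ℕ → Pat3 → Pat3 → ℤ)) (cert : List (ℕ × ℕ × ℕ)) (d : ℕ) (P Q : Pat3) : ℤ :=
  (cert.map fun c => (c.1 : ℤ) * (gentry (famGet gens c.2.2) c.2.1 d P Q + gentry (famGet gens c.2.2) c.2.1 d Q P)).sum

/-- **THE CERTIFICATE CHECK of a one-piece shape** (census g39's product-cone LP for `t = 1`, integer form): every shift fits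
below `dmax`, every generator index is valid, and at every residual level `d ≤ dmax` and every pattern pair the symmetrised
certificate row is dominated by `Dn` times the symmetrised coefficient table.  A `Bool`, checked by `decide`. [folklore] -/
def certCheck1 (coef : ℕ → Pat3 → Pat3 → ℤ) (gens : List (ℕ → Pat3 → Pat3 → ℤ)) (cert : List (ℕ × ℕ × ℕ))
    (Dn dmax : ℕ) : Bool :=
  (cert.all fun c => decide (c.2.1 + 1 ≤ dmax ∧ c.2.2 < gens.length)) &&
    ((List.range (dmax + 1)).all fun d => Pat3.list.all fun P => Pat3.list.all fun Q =>
      decide (certRow gens cert d P Q ≤ (Dn : ℤ) * (coef d P Q + coef d Q P)))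

omit [Fintype V] in
/-- Unpacking a passed certificate check. [folklore] -/
theorem certCheck1_spec {coef : ℕ → Pat3 → Pat3 → ℤ} {gens : List (ℕ → Pat3 → Pat3 → ℤ)} {cert : List (ℕ × ℕ × ℕ)}
    {Dn dmax : ℕ} (h : certCheck1 coef gens cert Dn dmax = true) :
    (∀ c ∈ cert, c.2.1 + 1 ≤ dmax ∧ c.2.2 < gens.length) ∧
      ∀ d ≤ dmax, ∀ P Q : Pat3, certRow gens cert d P Q ≤ (Dn : ℤ) * (coef d P Q + coef d Q P) := by
  unfold certCheck1 at h
  rw [Bool.and_eq_true, List.all_eq_true, List.all_eq_true] at h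
  refine ⟨fun c hc => of_decide_eq_true (h.1 c hc), fun d hd P Q => ?_⟩
  have h2 := h.2 d (List.mem_range.2 (by omega))
  rw [List.all_eq_true] at h2
  have h3 := h2 P (Pat3.mem_list P)
  rw [List.all_eq_true] at h3
  exact of_decide_eq_true (h3 Q (Pat3.mem_list Q))

omit [Fintype V] [DecidableEq ι] in
/-- The correction count of a fold is at most the number of edges folded. [folklore] -/
theorem foldBits_snd_le (R : ι → ι → Bool) (bits : List (ι × ι × Bool)) : (foldBits R bits).2 ≤ bits.length := by
  induction bits generalizing R with
  | nil => exact le_rfl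
  | cons e L ih =>
    obtain ⟨a, b, c⟩ := e
    rw [foldBits_cons, List.length_cons]
    have := ih (attachBit R a b c)
    split_ifs <;> omega

omit [Fintype V] [DecidableEq ι] in
/-- `zipBits` is no longer than the edge list. [folklore] -/
theorem length_zipBits_le (L : List (ι × ι)) (bs : List Bool) : (zipBits L bs).length ≤ L.length := by
  unfold zipBits; rw [List.length_zipWith]; exact min_le_left _ _

omit [Fintype V] in
/-- The corrections of a one-piece shape number at most `2|L| + 2`. [folklore] -/
theorem skelCorr_le (L : List (ι × ι)) (i j : ι) (bs : List Bool) (P Q : Pat3) : skelCorr L i j bs P Q ≤ 2 * L.length + 2 := by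
  unfold skelCorr
  have h1 := (foldBits_snd_le (idMat ι) (zipBits L bs)).trans (length_zipBits_le L bs)
  have h2 := (foldBits_snd_le (idMat ι) (zipBits L (bs.map (! ·)))).trans (length_zipBits_le L _)
  split_ifs <;> omega

omit [Fintype V] in
/-- The coefficient table vanishes above the structural level bound `2|L| + 3`. [folklore] -/
theorem coefTab1_eq_zero (L : List (ι × ι)) (i j k ix iy is : ι) (F : ℕ → Pat3 → Pat3 → ℤ) {d : ℕ}
    (hd : 2 * L.length + 3 < d) (P Q : Pat3) : coefTab1 L i j k ix iy is F d P Q = 0 := by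
  unfold coefTab1
  refine sumBits_eq_zero' L.length fun bs => ?_
  have h := skelCorr_le L i j bs P Q
  have e1 : ¬ (skelCorr L i j bs P Q = d) := by omega
  have e2 : ¬ (skelCorr L i j bs P Q + 1 = d) := by omega
  rw [if_neg e1, if_neg e2, add_zero]

omit [Fintype V] in
/-- Above `dmax` every certificate row vanishes (all shifts fit below `dmax`). [folklore] -/
theorem certRow_eq_zero {gens : List (ℕ → Pat3 → Pat3 → ℤ)} {cert : List (ℕ × ℕ × ℕ)} {dmax d : ℕ}
    (hc : ∀ c ∈ cert, c.2.1 + 1 ≤ dmax ∧ c.2.2 < gens.length) (hd : dmax < d) (P Q : Pat3) :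
    certRow gens cert d P Q = 0 := by
  unfold certRow
  rw [List.map_congr_left (fun c hc' => ?_), List.map_const', List.sum_replicate, smul_zero]
  have := (hc c hc').1
  have e1 : ¬ (c.2.1 = d) := by omega
  have e2 : ¬ (c.2.1 + 1 = d) := by omega
  simp [gentry, e1, e2]

omit [Fintype V] [DecidableEq ι] in
/-- Exchanging the configuration sum with the certificate's list sum. [folklore] -/
theorem sum_certRow_eq (EQ : Finset (Sym2 V)) (gens : List (ℕ → Pat3 → Pat3 → ℤ)) (cert : List (ℕ × ℕ × ℕ))
    (dOf : Finset (Sym2 V) → ℕ) (ok : Finset (Sym2 V) → Prop) [DecidablePred ok] (PP QQ : Finset (Sym2 V) → Pat3) :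
    ∑ γ ∈ EQ.powerset, (if ok γ then certRow gens cert (dOf γ) (PP γ) (QQ γ) else 0) =
      (cert.map fun c => (c.1 : ℤ) * ∑ γ ∈ EQ.powerset, (if ok γ then
        gentry (famGet gens c.2.2) c.2.1 (dOf γ) (PP γ) (QQ γ) + gentry (famGet gens c.2.2) c.2.1 (dOf γ) (QQ γ) (PP γ)
        else 0)).sum := by
  induction cert with
  | nil =>
    simp only [certRow, List.map_nil, List.sum_nil, ite_self, Finset.sum_const_zero]
  | cons c cs ih =>
    simp only [certRow, List.map_cons, List.sum_cons] at ih ⊢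
    rw [← ih, Finset.mul_sum, ← Finset.sum_add_distrib]
    refine Finset.sum_congr rfl fun γ _ => ?_
    split_ifs <;> simp

variable {p : ι → V} {L : List (ι × ι)} {EQ : Finset (Sym2 V)} {VQ : Set V} {u v m x y s : V} {i j k ix iy is : ι}

/-- **THE PRODUCT-CONE THEOREM FOR ONE-PIECE SHAPES, PIECE READ AS A MINOR** (census g39 §4 / §11 (iii)–(iv), `t = 1`: the
bridge 𝒯₂-rows B1/B2, the wheel and torso 𝒯₂-rows; in the minors form of census g37): if the certificate check passes for the
shape's coefficient table against a generator family that is levelwise nonnegative on the piece minor `(EQ, CQ; u, v, m)`, then the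
two-level table `F` is levelwise nonnegative on the composite minor `(plainSet p L ∪ EQ, CQ)` at `(x, y, s)`.  Proof:
`2·Dn·lev2C = Σ_γ Dn·(coef + coefᵀ)` (`FK.lev2C_shape1`, `FK.sum_shape1Term`, the flip `γ ↦ EQ \ γ` with `FK.apExpC_compl`)
`≥ Σ_γ certRow = Σ_c λ_c · 2·lev2C (EQ, CQ) (generator c) ≥ 0`. [cite: AyyerLinussonRavichandran2025, §7 (p. 22)] -/
theorem shape1C_nonneg_of_cert {CQ : Finset (Sym2 V)} (hinj : Function.Injective p)
    (hQ : ∀ e ∈ (↑(EQ ∪ CQ) : Set (Sym2 V)), ∀ z ∈ e, z ∈ VQ)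
    (huv : u ≠ v) (hmQ : m ∈ VQ) (hmu : m ≠ u) (hmv : m ≠ v) (hp : ∀ a, p a ∈ VQ → p a = u ∨ p a = v ∨ p a = m)
    (hi : p i = u) (hj : p j = v) (hk : p k = m) (hx : p ix = x) (hy : p iy = y) (hs : p is = s)
    (hL : ∀ e ∈ L, p e.1 ≠ p e.2) (hnd : (L.map (pedge p)).Nodup) (hLm : ∀ e ∈ L, p e.1 ≠ m ∧ p e.2 ≠ m)
    (hdQ : Disjoint (plainSet p L) EQ) (F : ℕ → Pat3 → Pat3 → ℤ)
    {gens : List (ℕ → Pat3 → Pat3 → ℤ)} {cert : List (ℕ × ℕ × ℕ)} {Dn dmax : ℕ} (hDn : 0 < Dn)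
    (hdm : 2 * L.length + 3 ≤ dmax) (hc : certCheck1 (coefTab1 L i j k ix iy is F) gens cert Dn dmax = true)
    (hg : ∀ n, n < gens.length → ∀ ν : ℕ, 0 ≤ lev2C EQ CQ u v m (famGet gens n) ν) (μ : ℕ) :
    0 ≤ lev2C (plainSet p L ∪ EQ) CQ x y s F μ := by
  obtain ⟨hshift, hrows⟩ := certCheck1_spec hc
  -- every row of the (symmetrised) cone inequality, at every residual level
  have hrow : ∀ d (P Q : Pat3), certRow gens cert d P Q ≤
      (Dn : ℤ) * (coefTab1 L i j k ix iy is F d P Q + coefTab1 L i j k ix iy is F d Q P) := by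
    intro d P Q
    by_cases hd : d ≤ dmax
    · exact hrows d hd P Q
    · rw [certRow_eq_zero hshift (by omega) P Q, coefTab1_eq_zero L i j k ix iy is F (by omega),
        coefTab1_eq_zero L i j k ix iy is F (by omega), add_zero, mul_zero]
  -- the composite value as a configuration sum of the piece, twice (once flipped)
  have hval : lev2C (plainSet p L ∪ EQ) CQ x y s F μ = ∑ γ ∈ EQ.powerset, (if apExpC EQ CQ γ ≤ μ + L.length then
      coefTab1 L i j k ix iy is F (μ + L.length - apExpC EQ CQ γ) (pat3 (γ ∪ CQ) u v m) (pat3 (EQ \ γ ∪ CQ) u v m) else 0) := by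
    rw [lev2C_shape1 hinj hQ huv hmQ hmu hmv hp hi hj hk hx hy hs hL hnd hLm hdQ F μ]
    exact Finset.sum_congr rfl fun γ _ => sum_shape1Term L i j k ix iy is F μ _ _ _
  have hval' : lev2C (plainSet p L ∪ EQ) CQ x y s F μ = ∑ γ ∈ EQ.powerset, (if apExpC EQ CQ γ ≤ μ + L.length then
      coefTab1 L i j k ix iy is F (μ + L.length - apExpC EQ CQ γ) (pat3 (EQ \ γ ∪ CQ) u v m) (pat3 (γ ∪ CQ) u v m) else 0) := by
    rw [hval, sum_powerset_flip EQ]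
    refine Finset.sum_congr rfl fun γ hγ => ?_
    have g := Finset.mem_powerset.1 hγ
    rw [Finset.sdiff_sdiff_eq_self g, apExpC_compl g]
  -- the generators' side
  have hgen : 0 ≤ ∑ γ ∈ EQ.powerset, (if apExpC EQ CQ γ ≤ μ + L.length then
      certRow gens cert (μ + L.length - apExpC EQ CQ γ) (pat3 (γ ∪ CQ) u v m) (pat3 (EQ \ γ ∪ CQ) u v m) else 0) := by
    rw [sum_certRow_eq]
    refine List.sum_nonneg ?_
    intro z hz
    rw [List.mem_map] at hz
    obtain ⟨c, hc', rfl⟩ := hz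
    refine mul_nonneg (by exact_mod_cast Nat.zero_le c.1) ?_
    have hn := (hshift c hc').2
    have hA : 0 ≤ ∑ γ ∈ EQ.powerset, (if apExpC EQ CQ γ ≤ μ + L.length then
        gentry (famGet gens c.2.2) c.2.1 (μ + L.length - apExpC EQ CQ γ) (pat3 (γ ∪ CQ) u v m) (pat3 (EQ \ γ ∪ CQ) u v m)
        else 0) := by
      rw [sum_gentryC]
      split_ifs
      · exact hg _ hn _
      · exact le_rfl
    have hB : ∑ γ ∈ EQ.powerset, (if apExpC EQ CQ γ ≤ μ + L.length then
        gentry (famGet gens c.2.2) c.2.1 (μ + L.length - apExpC EQ CQ γ) (pat3 (EQ \ γ ∪ CQ) u v m) (pat3 (γ ∪ CQ) u v m)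
        else 0) =
        ∑ γ ∈ EQ.powerset, (if apExpC EQ CQ γ ≤ μ + L.length then
        gentry (famGet gens c.2.2) c.2.1 (μ + L.length - apExpC EQ CQ γ) (pat3 (γ ∪ CQ) u v m) (pat3 (EQ \ γ ∪ CQ) u v m)
        else 0) := by
      rw [sum_powerset_flip EQ]
      refine Finset.sum_congr rfl fun γ hγ => ?_
      have g := Finset.mem_powerset.1 hγ
      rw [Finset.sdiff_sdiff_eq_self g, apExpC_compl g]
    have split : ∑ γ ∈ EQ.powerset, (if apExpC EQ CQ γ ≤ μ + L.length then
        gentry (famGet gens c.2.2) c.2.1 (μ + L.length - apExpC EQ CQ γ) (pat3 (γ ∪ CQ) u v m) (pat3 (EQ \ γ ∪ CQ) u v m) +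
          gentry (famGet gens c.2.2) c.2.1 (μ + L.length - apExpC EQ CQ γ) (pat3 (EQ \ γ ∪ CQ) u v m) (pat3 (γ ∪ CQ) u v m)
        else 0) =
        (∑ γ ∈ EQ.powerset, (if apExpC EQ CQ γ ≤ μ + L.length then
          gentry (famGet gens c.2.2) c.2.1 (μ + L.length - apExpC EQ CQ γ) (pat3 (γ ∪ CQ) u v m) (pat3 (EQ \ γ ∪ CQ) u v m)
          else 0)) +
        ∑ γ ∈ EQ.powerset, (if apExpC EQ CQ γ ≤ μ + L.length then
          gentry (famGet gens c.2.2) c.2.1 (μ + L.length - apExpC EQ CQ γ) (pat3 (EQ \ γ ∪ CQ) u v m) (pat3 (γ ∪ CQ) u v m)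
          else 0) := by
      rw [← Finset.sum_add_distrib]
      refine Finset.sum_congr rfl fun γ _ => ?_
      split_ifs <;> simp
    rw [split, hB]
    linarith
  -- assemble: `2 · Dn · lev2C ≥ Σ certRow ≥ 0`
  have hsum : ∑ γ ∈ EQ.powerset, (if apExpC EQ CQ γ ≤ μ + L.length then
      certRow gens cert (μ + L.length - apExpC EQ CQ γ) (pat3 (γ ∪ CQ) u v m) (pat3 (EQ \ γ ∪ CQ) u v m) else 0) ≤
      (Dn : ℤ) * (lev2C (plainSet p L ∪ EQ) CQ x y s F μ + lev2C (plainSet p L ∪ EQ) CQ x y s F μ) := by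
    rw [show (Dn : ℤ) * (lev2C (plainSet p L ∪ EQ) CQ x y s F μ + lev2C (plainSet p L ∪ EQ) CQ x y s F μ) =
        (Dn : ℤ) * lev2C (plainSet p L ∪ EQ) CQ x y s F μ + (Dn : ℤ) * lev2C (plainSet p L ∪ EQ) CQ x y s F μ by ring]
    conv_rhs => arg 1; rw [hval]
    conv_rhs => arg 2; rw [hval']
    rw [Finset.mul_sum, Finset.mul_sum, ← Finset.sum_add_distrib]
    refine Finset.sum_le_sum fun γ _ => ?_
    split_ifs with hl
    · rw [← mul_add]; exact hrow _ _ _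
    · simp
  have h2 : 0 ≤ (Dn : ℤ) * (lev2C (plainSet p L ∪ EQ) CQ x y s F μ + lev2C (plainSet p L ∪ EQ) CQ x y s F μ) :=
    hgen.trans hsum
  have hDn' : (0 : ℤ) < Dn := by exact_mod_cast hDn
  nlinarith

/-- **THE PRODUCT-CONE THEOREM FOR ONE-PIECE SHAPES** (nothing contracted): `FK.shape1C_nonneg_of_cert` with `CQ = ∅`.
[cite: AyyerLinussonRavichandran2025, §7 (p. 22)] -/
theorem shape1_nonneg_of_cert (hinj : Function.Injective p) (hQ : ∀ e ∈ (↑EQ : Set (Sym2 V)), ∀ z ∈ e, z ∈ VQ)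
    (huv : u ≠ v) (hmQ : m ∈ VQ) (hmu : m ≠ u) (hmv : m ≠ v) (hp : ∀ a, p a ∈ VQ → p a = u ∨ p a = v ∨ p a = m)
    (hi : p i = u) (hj : p j = v) (hk : p k = m) (hx : p ix = x) (hy : p iy = y) (hs : p is = s)
    (hL : ∀ e ∈ L, p e.1 ≠ p e.2) (hnd : (L.map (pedge p)).Nodup) (hLm : ∀ e ∈ L, p e.1 ≠ m ∧ p e.2 ≠ m)
    (hdQ : Disjoint (plainSet p L) EQ) (F : ℕ → Pat3 → Pat3 → ℤ)
    {gens : List (ℕ → Pat3 → Pat3 → ℤ)} {cert : List (ℕ × ℕ × ℕ)} {Dn dmax : ℕ} (hDn : 0 < Dn)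
    (hdm : 2 * L.length + 3 ≤ dmax) (hc : certCheck1 (coefTab1 L i j k ix iy is F) gens cert Dn dmax = true)
    (hg : ∀ n, n < gens.length → ∀ ν : ℕ, 0 ≤ lev2 EQ u v m (famGet gens n) ν) (μ : ℕ) :
    0 ≤ lev2 (plainSet p L ∪ EQ) x y s F μ := by
  rw [← lev2C_empty]
  exact shape1C_nonneg_of_cert (CQ := ∅) hinj (by rwa [Finset.union_empty]) huv hmQ hmu hmv hp hi hj hk hx hy hs hL hnd hLm
    hdQ F hDn hdm hc (fun n hn ν => by rw [lev2C_empty]; exact hg n hn ν) μ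

end ShapeOneCone

end FK

end Summit.CriticalPhenomena.PercolationContinuityZ3.Theorems
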